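import Literature.MathematicalPhysics.QuantumFieldTheory.Balaban1983to89.Beta.AliasRatioDerivs

/-!
# Beta/OmegaConormal — the k-UNIFORM CONORMAL CALCULUS of the partition weights `ω_λ(p′) = Δ^η_λ(p′_λ)/Δ^η(p′)`
# of Bałaban's symbol factorisation at U = 1 (β sub-cell row an1, node L1-OMEGA-CONORMAL; HOME/BETA/AN1.md §14.4–14.6)

HONEST FRAMING (cell `pub-balaban`, BETA-SPEC): discharging the flow-side hypothesis `BetaPertH` of Bałaban's
[Balaban1987RG1] Theorem 2 would make the ultraviolet STABILITY of four-dimensional pure Yang–Mills lattice gauge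
theory UNCONDITIONAL (in the interval-hypothesis sense of [Balaban1989LargeFieldII] p. 355) — a real constructive-QFT
result; it is NOT the continuum limit and NOT the Clay problem.  (Gloss 1, BETA-SPEC v1.8d l. 17–22, GAPS G-ref2-14 (a)
/ G-ref2-20 (a) / G-ref2-24 (a), verbatim: «UNCONDITIONAL» in [Balaban1989LargeFieldII] (B16) p. 355's interval-hypothesis
sense ONLY (`FlowStepRuns.p355Unconditional_of_partialSums` keeps `hnodes`); the located leaves G-adv3-2 (left inequality
of (0.1)/(2.50), d = 4), G-adv3-1 (U2 transfer of B14 Cor. 3's lower bound) and `SecondExpLeaf` REMAIN.  Gloss 2,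
BETA-SPEC v1.9e l. 23–25, beta-ref C-beta-78, BINDING: «UNCONDITIONAL» = `Beta.Assembly.EventualForm`-unconditional — the
END statement with the interval hypothesis removed, (0.31) in DEFECTED form on all lattices
(`PrefixAbsorption.thm2Defected_of_eventualForm`), admissible couplings shrunk to g ≤ g⋆; NOT «B12 Theorem 2 as printed»
(`eventualForm_not_thm2Printed`, RULING (R6)); never the continuum limit / mass gap / Clay.)  This module asserts
NOTHING about Bałaban's β-functions and introduces no `def … : Prop` hypothesis shape.  It proves [folklore] calculus
(elementary trigonometric inequalities and Cauchy's estimate iterated on polydiscs, `Beta.AliasRatioDerivs` §1) for the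
complex continuation of the partition weights `ω_λ = Δ^η_λ/Δ^η` of `Beta.SymbolExpansion` §7, which rewrite the printed
DEFINITIONS [Balaban1984PropagatorsI] (T. Bałaban, Propagators and renormalization transformations for lattice gauge
theories I, Commun. Math. Phys. **95** (1984) 17–40; INDEX B5) (1.61)–(1.62) p. 28 and (1.66)–(1.67) p. 29 at U = 1.
Nothing printed is used as a hypothesis; no upstream symbol is re-defined, no upstream inequality re-proved.

## Printed context (verbatim, with page; CONTEXT only)

* [Balaban1984PropagatorsI] (1.66)–(1.67) p. 29: `⟨B, Δ_k B⟩ = ⟨∂₁B, σ_k ∂₁B⟩` with the symbol `σ_{k,μν}(p′)` = the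
  bracket `[…]⁻¹` built from `a_λ = Δ₀φ_λ` (1.62) p. 28; in the tree `Beta.SymbolExpansion.sigmaSym`, and by
  `Beta.SymbolExpansion.sigmaSym_factorisation` (v2.2, §7) `σ_{k,μν} = F_k · [t_μ t_ν Σ_λ ω_λ/t_λ]⁻¹` on the punctured
  zone with `ω_λ = omegaW n λ` (`Σ_λ ω_λ = 1`, `sum_omegaW_eq_one`) and the alias ratios `t_λ` (`tRatio`).
* [Balaban1983RegularityDecay] (Commun. Math. Phys. **89** (1983) 571–597; INDEX B4) p. 586 [PDF 16], after (2.51):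
  «The expression is a function of p′ and can be extended as an analytic function to some neighbourhood of [−π,π]^d.
  It is more troublesome, but equally elementary, to prove that this neighbourhood can be chosen independently of j
  and that the expression is bounded also in this neighbourhood.»  For the alias ratios this is
  `Beta.AliasRatioStrip.statement_St` / `Beta.AliasRatioDerivs`; the partition weights `ω_λ(p′) = Δ^η_λ(p′_λ)/Δ^η(p′)`
  are NOT of this kind: they are homogeneous-of-degree-0-type at `p′ = 0` (discontinuous there) and `Δ^η` has complex
  zeros accumulating at small real momenta (`B4Strip.DeltaXi_poleWitness`), so NO `j`-independent complex neighbourhood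
  of `0` carries them.  The present module proves the correct replacement: analyticity and boundedness on polydiscs
  whose radius is PROPORTIONAL to `|p′|`, hence CONORMAL (symbol-type) derivative bounds `|∂^α ω_λ| ≤ C^m m^m |p′|^{−m}`.
* Cauchy's estimate on polydiscs: C. Laurent-Thiébaut, Holomorphic Function Theory in Several Variables (Springer
  2011), Ch. I Theorem 2.3 (2.4) [PDF p. 14] «|D^α f(a)| ≤ α!/r^α · sup_{P(a,r)} |f|»; used here only through the
  tree's iterated form `Beta.AliasRatioDerivs.norm_iterSliceDeriv_center_le` (`‖∂^α g(c)‖ ≤ M (m/R)^m`).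

## What is proved (every `n = L^k ≥ 1`, i.e. uniformly in k; `rOf d = 1/(4(d+1))`)

§1 `omegaC n κ q := S_ξ(q_κ)/Δ^ξ(q)` on `ℂ^d` and the real dictionary `omegaC_ofRealVec : omegaC n κ (ofRealVec s) =
omegaW n κ s`.  §2 `quarter_sq_le_Sxir : |x| ≤ π + 1/4 → x²/4 ≤ Sxir n x (= 4n² sin²(x/2n))` and
`d_mul_rOf_sq_le_64 : d·rOf(d)² ≤ 1/64`.  §3 THE CONE POLYDISC `PolyBox (ofRealVec s) (rOf d · ρ)` about a real
momentum `s` of the zone (`|s_ν| ≤ π`) at a scale `0 < ρ ≤ 1` with `ρ ≤ |s_{ν₀}|` for some `ν₀`: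
`norm_DeltaXi_zero_ge_cone : ρ²/9 ≤ ‖Δ^ξ(q)‖`, `DeltaXi_zero_ne_zero_cone`, `analyticAt_omegaC : AnalyticAt ℂ (omegaC n κ) q`
and, when also `|s_ν| ≤ 4ρ` for all `ν`, `norm_omegaC_le : ‖omegaC n κ q‖ ≤ 164`.  §4 THE CONORMAL BOUNDS at the real
point `s`, for EVERY list `α` of coordinates (`m = |α|`): `norm_iterSliceDeriv_omegaC_le : ‖∂^α ω_κ (s)‖ ≤
164·(m/(rOf(d)ρ))^m`; `conePolyBox_subset_Fat` (the cone polydisc lies in `Fat d (rOf d)`); with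
`C_ωt(d) = Cwt d := 164·C_T⁽⁴⁾(d)·d²·(289/16)²`: `norm_omegaC_mul_tSubOne_le : ‖ω_κ(q)(t_λ(q) − 1)‖ ≤ C_ωt(d) ρ⁴` on the
cone polydisc and `norm_iterSliceDeriv_omegaC_mul_tSubOne_le : ‖∂^α[ω_κ(t_λ − 1)](s)‖ ≤ C_ωt(d)·ρ⁴·(m/(rOf(d)ρ))^m`
(clean forms `…_vanishing` for `m ≤ 4`: `≤ C_ωt(d)·(m^m/rOf(d)^m)·ρ^{4−m}`, and `…_high` for `m ≥ 4`).  Both admissible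
choices of the scale are covered: `ρ = max_ν |s_ν| ≤ 1` (near `p′ = 0`: the conormal reading
`|∂^α ω_λ(p′)| ≤ C_m(d)|p′|^{−m}`, `|∂^α[ω_λ(t_λ′ − 1)](p′)| ≤ C_m(d)|p′|^{4−m}`) and `ρ = 1 ≤ max_ν |s_ν|` (away from
`0`: plain k-uniform bounds on all derivatives).

## What this is for, and what it is NOT

HOME/BETA/AN1.md §14.4–14.6 / §15.7: in the exact factorisation (F0) the bracket `B = t_μ t_ν Σ_λ ω_λ/t_λ` satisfies
`B − 1 = (t_μ t_ν − 1) + t_μ t_ν Σ_λ ω_λ (1/t_λ − 1)`, so ALL non-analytic content of `σ_k` at U = 1 enters through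
products `ω_λ × (analytic, O(|p′|⁴))`; the k-uniform order-4 conormal calculus of such products (here for the model
product `ω_κ·(t_λ − 1)`; `t_λ − 1 = tSubOne` is analytic and `O((Σ‖q_ν‖²)²)` on `Fat d (rOf d)` by
`Beta.AliasRatioStrip.norm_tSubOne_le_pow_four`) is the input the (T-drift) discussion of AN1 §14.6 asks for
(«Cauchy estimates turn (S_t) into |∂^α(σ_k − F_k)| ≤ C_α|p′|^{4−|α|}» — for the `ω`-weighted terms this is the
precise sense).  With `Beta.AliasRatioStrip` (t_λ: strip holomorphy, (S_t)) and `Beta.AliasRatioDerivs` (t_λ: all-order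
bounds, vanishing order) every factor of (F0) other than the explicit `F_k` now has its k-uniform regularity in the
kernel.  NOT covered: anything at U ≠ 1, the Woodbury blocks (1.70)–(1.83), the background-field vertices
(BETA-SPEC 7.8 (iii)), the (T-drift) momentum-space estimate itself (it needs the fluctuation-covariance side), and —
of course — any statement about β.  Value = kernel certificate of a located (L1) input, NOT summit progress.
-/

namespace Literature.MathematicalPhysics.QuantumFieldTheory.Balaban1983to89.Beta.OmegaConormal

open Finset Metric
open Literature.MathematicalPhysics.QuantumFieldTheory.Balaban1983to89.B4Strip
open Literature.MathematicalPhysics.QuantumFieldTheory.Balaban1983to89.B4StripCauchy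
open Literature.MathematicalPhysics.QuantumFieldTheory.Balaban1983to89.Beta.SymbolExpansion (omegaW)
open Literature.MathematicalPhysics.QuantumFieldTheory.Balaban1983to89.Beta.AliasRatioStrip
open Literature.MathematicalPhysics.QuantumFieldTheory.Balaban1983to89.Beta.AliasRatioDerivs

noncomputable section

variable {d : ℕ}

/-! ## §1. The complex partition weights and the real dictionary -/

/-- the partition weight `ω_κ(q) := S_ξ(q_κ)/Δ^ξ(q)` (`ξ = 1/n`, `m² = 0`) continued to complex momenta `q ∈ ℂ^d`
(on real momenta it is `Beta.SymbolExpansion.omegaW`, see `omegaC_ofRealVec`). [folklore] -/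
def omegaC (n : ℕ) (κ : Fin d) (q : Fin d → ℂ) : ℂ := Sxi n (q κ) / DeltaXi n 0 q

/-- REAL DICTIONARY: on real momenta `omegaC` is the partition weight `omegaW n κ s = Sxir n (s κ)/DeltaXir n 0 s` of
`Beta.SymbolExpansion` (the weights `ω_λ` of the exact factorisation `sigmaSym_factorisation`). [folklore] -/
theorem omegaC_ofRealVec (n : ℕ) (κ : Fin d) (s : Fin d → ℝ) :
    omegaC n κ (ofRealVec s) = ((omegaW n κ s : ℝ) : ℂ) := by
  unfold omegaC omegaW
  rw [show ofRealVec s κ = ((s κ : ℝ) : ℂ) from rfl, Sxi_ofReal, DeltaXi_ofReal, Complex.ofReal_div]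

/-! ## §2. One real variable: a quarter-square lower bound for `4n² sin²(x/2n)` slightly beyond the zone -/

/-- `x²/4 ≤ 4n² sin²(x/(2n)) (= Sxir n x)` for `|x| ≤ π + 1/4` and EVERY `n ≥ 1` (Jordan's inequality for `|x| ≤ nπ`;
for `n = 1`, `π ≤ |x| ≤ π + 1/4` the tree's `Beta.AliasRatioStrip.sin_sq_half_ge`). [folklore] -/
theorem quarter_sq_le_Sxir (n : ℕ) (hn : 1 ≤ n) {x : ℝ} (hx : |x| ≤ Real.pi + 1 / 4) :
    x ^ 2 / 4 ≤ Sxir n x := by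
  have hπ3 := Real.pi_gt_three
  have hπ4 : Real.pi ≤ 4 := Real.pi_le_four
  have hn' : (1 : ℝ) ≤ n := by exact_mod_cast hn
  have hn0 : (0 : ℝ) < n := by positivity
  rcases le_or_gt |x| (n * Real.pi) with h | h
  · have h1 : |x / n| ≤ Real.pi := by
      rw [abs_div, abs_of_pos hn0, div_le_iff₀ hn0]
      linarith [mul_comm (n : ℝ) Real.pi]
    have h2 := S1r_ge (x / n) h1
    have h3 : Sxir n x = (n : ℝ) ^ 2 * S1r (x / n) := rfl
    have h4 : (n : ℝ) ^ 2 * (4 * (x / n) ^ 2 / Real.pi ^ 2) = 4 * x ^ 2 / Real.pi ^ 2 := by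
      field_simp
    have h5 : x ^ 2 / 4 ≤ 4 * x ^ 2 / Real.pi ^ 2 := by
      rw [div_le_div_iff₀ (by norm_num) (by positivity)]
      have : Real.pi ^ 2 ≤ 16 := by nlinarith
      nlinarith [sq_nonneg x]
    calc x ^ 2 / 4 ≤ 4 * x ^ 2 / Real.pi ^ 2 := h5
      _ = (n : ℝ) ^ 2 * (4 * (x / n) ^ 2 / Real.pi ^ 2) := h4.symm
      _ ≤ (n : ℝ) ^ 2 * S1r (x / n) := by gcongr
      _ = Sxir n x := h3.symm
  · -- then `n = 1` and `π < |x| ≤ π + 1/4`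
    have hn1 : n = 1 := by
      by_contra hne
      have h2 : (2 : ℝ) ≤ n := by exact_mod_cast (show 2 ≤ n by omega)
      nlinarith
    subst hn1
    have hπx : Real.pi ≤ |x| := by simpa using h.le
    have hs := sin_sq_half_ge hπx hx
    have hlt := Real.pi_lt_d2
    have hx2 : x ^ 2 ≤ 12 := by
      have hax : |x| ≤ 3.4 := by linarith
      nlinarith [abs_nonneg x, sq_abs x]
    rw [Sxir_eq]
    norm_num
    nlinarith

/-- `d · rOf(d)² ≤ 1/64` (`rOf d = 1/(4(d+1))`; sharper than the tree's `d_mul_rOf_sq_le : ≤ 1/16`). [folklore] -/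
theorem d_mul_rOf_sq_le_64 (d : ℕ) : (d : ℝ) * rOf d ^ 2 ≤ 1 / 64 := by
  unfold rOf
  have hd : (0 : ℝ) ≤ d := Nat.cast_nonneg d
  rw [div_pow, one_pow, mul_one_div, div_le_div_iff₀ (by positivity) (by norm_num)]
  nlinarith [sq_nonneg ((d : ℝ) - 1)]

/-! ## §3. The CONE POLYDISC about a real momentum: `Δ^ξ` stays away from zero, `ω_κ` is analytic and bounded -/

/-- coordinates on the cone polydisc `PolyBox (ofRealVec s) R`: `|Re q_ν − s_ν| ≤ R` and `|Im q_ν| ≤ R`. [folklore] -/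
theorem re_im_of_mem_polyBox {s : Fin d → ℝ} {R : ℝ} {q : Fin d → ℂ} (hq : q ∈ PolyBox (ofRealVec s) R) (ν : Fin d) :
    |(q ν).re - s ν| ≤ R ∧ |(q ν).im| ≤ R := by
  have h := hq ν
  have e : q ν - ofRealVec s ν = q ν - ((s ν : ℝ) : ℂ) := rfl
  rw [e] at h
  refine ⟨?_, ?_⟩
  · have h1 := Complex.abs_re_le_norm (q ν - ((s ν : ℝ) : ℂ))
    simp only [Complex.sub_re, Complex.ofReal_re] at h1
    exact h1.trans h
  · have h1 := Complex.abs_im_le_norm (q ν - ((s ν : ℝ) : ℂ))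
    simp only [Complex.sub_im, Complex.ofReal_im, sub_zero] at h1
    exact h1.trans h

/-- **`‖Δ^ξ(q)‖ ≥ ρ²/9` ON THE CONE POLYDISC**, for EVERY `n ≥ 1`: for a real momentum `s` in the zone (`|s_ν| ≤ π`),
a scale `0 < ρ ≤ 1` with `ρ ≤ |s_{ν₀}|` for some `ν₀` (e.g. `ρ = min(max_ν |s_ν|, 1)`), and every complex `q` with
`‖q_ν − s_ν‖ ≤ rOf(d)·ρ` for all `ν`: `ρ²/9 ≤ ‖Δ^ξ(q)‖` (`Re S_ξ(q_ν) ≥ 4n²sin²(Re q_ν/2n) − (25/16)(Im q_ν)²`,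
the `ν₀` term `≥ (3ρ/4)²/4`, and `d·rOf(d)² ≤ 1/64`).  The radius MUST shrink with `ρ`: `Δ^ξ` has complex zeros at
distance `O(|s|)` from small real momenta (`B4Strip.DeltaXi_poleWitness`). [folklore] -/
theorem norm_DeltaXi_zero_ge_cone (n : ℕ) (hn : 1 ≤ n) {s : Fin d → ℝ} (hs : ∀ ν, |s ν| ≤ Real.pi) {ρ : ℝ}
    (hρ : 0 < ρ) (hρ1 : ρ ≤ 1) {ν₀ : Fin d} (hν₀ : ρ ≤ |s ν₀|) {q : Fin d → ℂ}
    (hq : q ∈ PolyBox (ofRealVec s) (rOf d * ρ)) : ρ ^ 2 / 9 ≤ ‖DeltaXi n 0 q‖ := by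
  have hr4 := rOf_le d
  have hr0 := rOf_pos d
  have hd64 := d_mul_rOf_sq_le_64 d
  have hπ := Real.pi_gt_three
  have hR : rOf d * ρ ≤ ρ / 4 := by nlinarith
  have hco := fun ν => re_im_of_mem_polyBox hq ν
  have him1 : ∀ ν, |(q ν).im| ≤ 1 := fun ν => by linarith [(hco ν).2]
  -- real part of `Δ^ξ(q)`
  have hre : (DeltaXi n 0 q).re = ∑ ν, (Sxi n (q ν)).re := by
    unfold DeltaXi
    rw [Complex.add_re, Complex.re_sum, Complex.ofReal_re, add_zero]
  -- termwise lower bound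
  have hterm : ∀ ν, 4 * (n : ℝ) ^ 2 * Real.sin ((q ν).re / (2 * n)) ^ 2 - 25 / 16 * (q ν).im ^ 2 ≤
      (Sxi n (q ν)).re := fun ν => re_Sxi_ge n hn (q ν) (him1 ν)
  have hsum : (∑ ν, 4 * (n : ℝ) ^ 2 * Real.sin ((q ν).re / (2 * n)) ^ 2) - 25 / 16 * ∑ ν, (q ν).im ^ 2 ≤
      ∑ ν, (Sxi n (q ν)).re := by
    rw [Finset.mul_sum, ← Finset.sum_sub_distrib]
    exact Finset.sum_le_sum (fun ν _ => hterm ν)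
  -- the `ν₀` term
  have hx0 : |(q ν₀).re| ≤ Real.pi + 1 / 4 := by
    have h1 := (hco ν₀).1
    have h2 : |(q ν₀).re| ≤ |(q ν₀).re - s ν₀| + |s ν₀| := by
      have := abs_add_le ((q ν₀).re - s ν₀) (s ν₀); simpa using this
    linarith [hs ν₀]
  have hq0 : 3 * ρ / 4 ≤ |(q ν₀).re| := by
    have h1 := (hco ν₀).1
    have h2 : |s ν₀| ≤ |(q ν₀).re| + |(q ν₀).re - s ν₀| := by
      have := abs_sub_abs_le_abs_sub (s ν₀) ((q ν₀).re)
      rw [abs_sub_comm] at this; linarith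
    linarith
  have hsin0 : (3 * ρ / 4) ^ 2 / 4 ≤ 4 * (n : ℝ) ^ 2 * Real.sin ((q ν₀).re / (2 * n)) ^ 2 := by
    have h1 := quarter_sq_le_Sxir n hn hx0
    rw [Sxir_eq] at h1
    have h2 : (3 * ρ / 4) ^ 2 ≤ (q ν₀).re ^ 2 := by
      rw [← sq_abs ((q ν₀).re)]
      exact pow_le_pow_left₀ (by positivity) hq0 2
    linarith
  have hsingle : 4 * (n : ℝ) ^ 2 * Real.sin ((q ν₀).re / (2 * n)) ^ 2 ≤
      ∑ ν, 4 * (n : ℝ) ^ 2 * Real.sin ((q ν).re / (2 * n)) ^ 2 :=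
    Finset.single_le_sum (f := fun ν => 4 * (n : ℝ) ^ 2 * Real.sin ((q ν).re / (2 * n)) ^ 2)
      (fun ν _ => by positivity) (Finset.mem_univ ν₀)
  -- the imaginary parts
  have him : ∑ ν, (q ν).im ^ 2 ≤ ρ ^ 2 / 64 := by
    calc ∑ ν, (q ν).im ^ 2 ≤ ∑ _ν : Fin d, (rOf d * ρ) ^ 2 := by
          refine Finset.sum_le_sum (fun ν _ => ?_)
          rw [← sq_abs]
          exact pow_le_pow_left₀ (abs_nonneg _) (hco ν).2 2
      _ = ((d : ℝ) * rOf d ^ 2) * ρ ^ 2 := by simp; ring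
      _ ≤ 1 / 64 * ρ ^ 2 := by gcongr
      _ = ρ ^ 2 / 64 := by ring
  have hreal : ρ ^ 2 / 9 ≤ (DeltaXi n 0 q).re := by
    rw [hre]
    nlinarith
  exact hreal.trans (Complex.re_le_norm _)

/-- `Δ^ξ(q) ≠ 0` on the cone polydisc. [folklore] -/
theorem DeltaXi_zero_ne_zero_cone (n : ℕ) (hn : 1 ≤ n) {s : Fin d → ℝ} (hs : ∀ ν, |s ν| ≤ Real.pi) {ρ : ℝ}
    (hρ : 0 < ρ) (hρ1 : ρ ≤ 1) {ν₀ : Fin d} (hν₀ : ρ ≤ |s ν₀|) {q : Fin d → ℂ}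
    (hq : q ∈ PolyBox (ofRealVec s) (rOf d * ρ)) : DeltaXi n 0 q ≠ 0 := by
  intro h
  have := norm_DeltaXi_zero_ge_cone n hn hs hρ hρ1 hν₀ hq
  rw [h, norm_zero] at this
  nlinarith

/-- **`ω_κ` IS ANALYTIC ON THE CONE POLYDISC**, for EVERY `n ≥ 1` (quotient of entire functions, denominator `≠ 0`).
[folklore] -/
theorem analyticAt_omegaC (n : ℕ) (hn : 1 ≤ n) (κ : Fin d) {s : Fin d → ℝ} (hs : ∀ ν, |s ν| ≤ Real.pi) {ρ : ℝ}
    (hρ : 0 < ρ) (hρ1 : ρ ≤ 1) {ν₀ : Fin d} (hν₀ : ρ ≤ |s ν₀|) {q : Fin d → ℂ}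
    (hq : q ∈ PolyBox (ofRealVec s) (rOf d * ρ)) : AnalyticAt ℂ (omegaC n κ) q := by
  have h1 : AnalyticAt ℂ (fun p : Fin d → ℂ => Sxi n (p κ)) q :=
    (analyticAt_Sxi n (q κ)).comp (f := fun p : Fin d → ℂ => p κ) (analyticAt_eval κ q)
  exact h1.div (analyticAt_DeltaXi n 0 q) (DeltaXi_zero_ne_zero_cone n hn hs hρ hρ1 hν₀ hq)

/-- **`‖ω_κ‖ ≤ 164` ON THE CONE POLYDISC**, for EVERY `n ≥ 1`, when moreover `|s_ν| ≤ 4ρ` for all `ν` (so `ρ` is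
comparable with `max_ν |s_ν|` — both `ρ = max_ν|s_ν| ≤ 1` and `ρ = 1 ≤ max_ν|s_ν| ≤ π` qualify): numerator
`‖S_ξ(q_κ)‖ ≤ (Re q_κ)² + (25/16)(Im q_κ)² ≤ (4649/256)ρ²`, denominator `≥ ρ²/9`. [folklore] -/
theorem norm_omegaC_le (n : ℕ) (hn : 1 ≤ n) (κ : Fin d) {s : Fin d → ℝ} (hs : ∀ ν, |s ν| ≤ Real.pi) {ρ : ℝ}
    (hρ : 0 < ρ) (hρ1 : ρ ≤ 1) {ν₀ : Fin d} (hν₀ : ρ ≤ |s ν₀|) (h4 : ∀ ν, |s ν| ≤ 4 * ρ) {q : Fin d → ℂ}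
    (hq : q ∈ PolyBox (ofRealVec s) (rOf d * ρ)) : ‖omegaC n κ q‖ ≤ 164 := by
  have hr4 := rOf_le d
  have hr0 := rOf_pos d
  have hR : rOf d * ρ ≤ ρ / 4 := by nlinarith
  have hco := re_im_of_mem_polyBox hq κ
  have him1 : |(q κ).im| ≤ 1 := by linarith [hco.2]
  have hD := norm_DeltaXi_zero_ge_cone n hn hs hρ hρ1 hν₀ hq
  have hDpos : 0 < ‖DeltaXi n 0 q‖ := lt_of_lt_of_le (by positivity) hD
  have hnum : ‖Sxi n (q κ)‖ ≤ 4649 / 256 * ρ ^ 2 := by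
    have h1 := norm_Sxi_le n hn (q κ) him1
    have hre : |(q κ).re| ≤ 17 * ρ / 4 := by
      have h2 : |(q κ).re| ≤ |(q κ).re - s κ| + |s κ| := by
        have := abs_add_le ((q κ).re - s κ) (s κ); simpa using this
      linarith [h4 κ, hco.1]
    have hre2 : (q κ).re ^ 2 ≤ (17 * ρ / 4) ^ 2 := by
      rw [← sq_abs]; exact pow_le_pow_left₀ (abs_nonneg _) hre 2
    have him2 : (q κ).im ^ 2 ≤ (ρ / 4) ^ 2 := by
      rw [← sq_abs]; exact pow_le_pow_left₀ (abs_nonneg _) (hco.2.trans hR) 2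
    nlinarith
  unfold omegaC
  rw [norm_div, div_le_iff₀ hDpos]
  nlinarith

/-! ## §4. ALL-ORDER, k-UNIFORM CONORMAL BOUNDS at real momenta -/

/-- **CONORMAL BOUNDS FOR THE PARTITION WEIGHTS**: for EVERY `n ≥ 1`, `κ`, every real momentum `s` in the zone, every
scale `0 < ρ ≤ 1` with `ρ ≤ |s_{ν₀}|`, `|s_ν| ≤ 4ρ`, and every multi-index `α` (`m = |α|`):
`‖∂^α ω_κ (s)‖ ≤ 164 · (m/(rOf(d)·ρ))^m` — i.e. `|∂^α ω_κ(p′)| ≤ C(d)^m m^m |p′|^{−|α|}` near `p′ = 0` (order-0 conormal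
symbol, `ρ = max_ν|p′_ν|`) and plain boundedness of all derivatives away from it (`ρ = 1`); Cauchy iteration
`Beta.AliasRatioDerivs.norm_iterSliceDeriv_center_le` on the cone polydisc of §3. [folklore] -/
theorem norm_iterSliceDeriv_omegaC_le (n : ℕ) (hn : 1 ≤ n) (κ : Fin d) {s : Fin d → ℝ}
    (hs : ∀ ν, |s ν| ≤ Real.pi) {ρ : ℝ} (hρ : 0 < ρ) (hρ1 : ρ ≤ 1) {ν₀ : Fin d} (hν₀ : ρ ≤ |s ν₀|)
    (h4 : ∀ ν, |s ν| ≤ 4 * ρ) (α : List (Fin d)) :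
    ‖iterSliceDeriv (omegaC n κ) α (ofRealVec s)‖ ≤ 164 * ((α.length : ℝ) / (rOf d * ρ)) ^ α.length :=
  norm_iterSliceDeriv_center_le (omegaC n κ) (mul_pos (rOf_pos d) hρ)
    (fun _ hq => analyticAt_omegaC n hn κ hs hρ hρ1 hν₀ hq)
    (fun _ hq => norm_omegaC_le n hn κ hs hρ hρ1 hν₀ h4 hq) α

/-- the cone polydisc lies in the standard fat region `Fat d (rOf d)` (so the `tSubOne` bounds of
`Beta.AliasRatioStrip` / `Beta.AliasRatioDerivs` apply on it). [folklore] -/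
theorem conePolyBox_subset_Fat {s : Fin d → ℝ} (hs : ∀ ν, |s ν| ≤ Real.pi) {ρ : ℝ} (hρ1 : ρ ≤ 1) :
    PolyBox (ofRealVec s) (rOf d * ρ) ⊆ Fat d (rOf d) := by
  have hr0 := rOf_pos d
  refine polyBox_subset_Fat (ofRealVec_mem_Strip_zero hs) ?_ ?_
  · nlinarith
  · nlinarith

/-- the constant of the product bound: `C_ωt(d) := 164 · C_T⁽⁴⁾(d) · d² · (289/16)²`. [folklore] -/
def Cwt (d : ℕ) : ℝ := 164 * CT4 d * (d : ℝ) ^ 2 * (289 / 16) ^ 2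

/-- `0 ≤ C_ωt(d)`. [folklore] -/
theorem Cwt_nonneg (d : ℕ) : 0 ≤ Cwt d := by unfold Cwt; have := CT4_nonneg d; positivity

/-- on the cone polydisc `‖ω_κ(q)·(t_λ(q) − 1)‖ ≤ C_ωt(d)·ρ⁴` (`‖q_ν‖ ≤ |s_ν| + rOf(d)ρ ≤ 17ρ/4`, so
`(Σ‖q_ν‖²)² ≤ d²(289/16)²ρ⁴` in `Beta.AliasRatioStrip.norm_tSubOne_le_pow_four`). [folklore] -/
theorem norm_omegaC_mul_tSubOne_le (n : ℕ) [NeZero n] (κ lam : Fin d) {s : Fin d → ℝ}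
    (hs : ∀ ν, |s ν| ≤ Real.pi) {ρ : ℝ} (hρ : 0 < ρ) (hρ1 : ρ ≤ 1) {ν₀ : Fin d} (hν₀ : ρ ≤ |s ν₀|)
    (h4 : ∀ ν, |s ν| ≤ 4 * ρ) {q : Fin d → ℂ} (hq : q ∈ PolyBox (ofRealVec s) (rOf d * ρ)) :
    ‖omegaC n κ q * tSubOne n lam q‖ ≤ Cwt d * ρ ^ 4 := by
  have hn : 1 ≤ n := Nat.one_le_iff_ne_zero.mpr (NeZero.ne n)
  have hr4 := rOf_le d
  have hr0 := rOf_pos d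
  have hR : rOf d * ρ ≤ ρ / 4 := by nlinarith
  have hFat := conePolyBox_subset_Fat hs hρ1 hq
  have h1 := norm_omegaC_le n hn κ hs hρ hρ1 hν₀ h4 hq
  have h2 := norm_tSubOne_le_pow_four n lam (rOf_le d) (d_mul_rOf_sq_le d) hFat
  have hqn : ∀ ν, ‖q ν‖ ≤ 17 * ρ / 4 := fun ν => by
    have e : q ν = (q ν - ofRealVec s ν) + ofRealVec s ν := by ring
    have h3 : ‖ofRealVec s ν‖ = |s ν| := by
      show ‖((s ν : ℝ) : ℂ)‖ = |s ν|
      rw [Complex.norm_real, Real.norm_eq_abs]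
    calc ‖q ν‖ = ‖(q ν - ofRealVec s ν) + ofRealVec s ν‖ := by rw [← e]
      _ ≤ ‖q ν - ofRealVec s ν‖ + ‖ofRealVec s ν‖ := norm_add_le _ _
      _ ≤ rOf d * ρ + |s ν| := by rw [h3]; exact add_le_add (hq ν) le_rfl
      _ ≤ 17 * ρ / 4 := by linarith [h4 ν]
  have h5 : ∑ ν, ‖q ν‖ ^ 2 ≤ (d : ℝ) * (17 * ρ / 4) ^ 2 := by
    calc ∑ ν, ‖q ν‖ ^ 2 ≤ ∑ _ν : Fin d, (17 * ρ / 4) ^ 2 :=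
          Finset.sum_le_sum (fun ν _ => pow_le_pow_left₀ (norm_nonneg _) (hqn ν) 2)
      _ = (d : ℝ) * (17 * ρ / 4) ^ 2 := by simp
  have h0 : 0 ≤ ∑ ν, ‖q ν‖ ^ 2 := Finset.sum_nonneg (fun _ _ => by positivity)
  have h6 : ‖tSubOne n lam q‖ ≤ CT4 d * ((d : ℝ) * (17 * ρ / 4) ^ 2) ^ 2 :=
    h2.trans (mul_le_mul_of_nonneg_left (pow_le_pow_left₀ h0 h5 2) (CT4_nonneg d))
  have hC := CT4_nonneg d
  calc ‖omegaC n κ q * tSubOne n lam q‖ ≤ ‖omegaC n κ q‖ * ‖tSubOne n lam q‖ := norm_mul_le _ _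
    _ ≤ 164 * (CT4 d * ((d : ℝ) * (17 * ρ / 4) ^ 2) ^ 2) :=
        mul_le_mul h1 h6 (norm_nonneg _) (by norm_num)
    _ = Cwt d * ρ ^ 4 := by unfold Cwt; ring

/-- **THE BRACKET GERM IS AN ORDER-4 CONORMAL SYMBOL, k-UNIFORMLY**: for EVERY `n ≥ 1`, directions `κ, λ`, real `s` in
the zone, scale `0 < ρ ≤ 1` with `ρ ≤ |s_{ν₀}|`, `|s_ν| ≤ 4ρ`, and EVERY multi-index `α` (`m = |α|`, no restriction
`m ≤ 4`): `‖∂^α [ω_κ · (t_λ − 1)] (s)‖ ≤ C_ωt(d) · ρ⁴ · (m/(rOf(d)·ρ))^m` — the products `ω_λ × (t_λ′ − 1)` through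
which ALL non-analytic content of Bałaban's `σ_k` enters (HOME/BETA/AN1.md §14.5 (F3)) satisfy
`|∂^α(·)(p′)| ≤ C_α(d) |p′|^{4−|α|}` near `p′ = 0`, uniformly in `k`. [folklore] -/
theorem norm_iterSliceDeriv_omegaC_mul_tSubOne_le (n : ℕ) [NeZero n] (κ lam : Fin d) {s : Fin d → ℝ}
    (hs : ∀ ν, |s ν| ≤ Real.pi) {ρ : ℝ} (hρ : 0 < ρ) (hρ1 : ρ ≤ 1) {ν₀ : Fin d} (hν₀ : ρ ≤ |s ν₀|)
    (h4 : ∀ ν, |s ν| ≤ 4 * ρ) (α : List (Fin d)) :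
    ‖iterSliceDeriv (fun q => omegaC n κ q * tSubOne n lam q) α (ofRealVec s)‖ ≤
      Cwt d * ρ ^ 4 * ((α.length : ℝ) / (rOf d * ρ)) ^ α.length := by
  have hn : 1 ≤ n := Nat.one_le_iff_ne_zero.mpr (NeZero.ne n)
  have hFat := conePolyBox_subset_Fat (d := d) hs hρ1
  exact norm_iterSliceDeriv_center_le (fun q => omegaC n κ q * tSubOne n lam q) (mul_pos (rOf_pos d) hρ)
    (fun q hq => (analyticAt_omegaC n hn κ hs hρ hρ1 hν₀ hq).mul
      (analyticAt_tSubOne n lam (rOf_le d) (d_mul_rOf_sq_le d) (hFat hq)))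
    (fun q hq => norm_omegaC_mul_tSubOne_le n κ lam hs hρ hρ1 hν₀ h4 hq) α

/-- **CLEAN FORM FOR `m ≤ 4`**: `‖∂^α [ω_κ(t_λ − 1)] (s)‖ ≤ C_ωt(d) · m^m/rOf(d)^m · ρ^{4−m}`. [folklore] -/
theorem norm_iterSliceDeriv_omegaC_mul_tSubOne_le_vanishing (n : ℕ) [NeZero n] (κ lam : Fin d)
    {s : Fin d → ℝ} (hs : ∀ ν, |s ν| ≤ Real.pi) {ρ : ℝ} (hρ : 0 < ρ) (hρ1 : ρ ≤ 1) {ν₀ : Fin d}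
    (hν₀ : ρ ≤ |s ν₀|) (h4 : ∀ ν, |s ν| ≤ 4 * ρ) (α : List (Fin d)) (hm : α.length ≤ 4) :
    ‖iterSliceDeriv (fun q => omegaC n κ q * tSubOne n lam q) α (ofRealVec s)‖ ≤
      Cwt d * ((α.length : ℝ) ^ α.length / rOf d ^ α.length) * ρ ^ (4 - α.length) := by
  have h := norm_iterSliceDeriv_omegaC_mul_tSubOne_le n κ lam hs hρ hρ1 hν₀ h4 α
  have hr0 := rOf_pos d
  have hm' : α.length + (4 - α.length) = 4 := Nat.add_sub_of_le hm
  have key : Cwt d * ρ ^ 4 * ((α.length : ℝ) / (rOf d * ρ)) ^ α.length =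
      Cwt d * ((α.length : ℝ) ^ α.length / rOf d ^ α.length) * ρ ^ (4 - α.length) := by
    rw [div_pow, mul_pow]
    have hρ4 : ρ ^ 4 = ρ ^ α.length * ρ ^ (4 - α.length) := by rw [← pow_add, hm']
    rw [hρ4]
    field_simp
  rw [key] at h
  exact h

/-- **CLEAN FORM FOR `m ≥ 4`**: `‖∂^α [ω_κ(t_λ − 1)] (s)‖ ≤ C_ωt(d) · m^m/rOf(d)^m / ρ^{m−4}` (the conormal growth
of the high derivatives at small momenta). [folklore] -/
theorem norm_iterSliceDeriv_omegaC_mul_tSubOne_le_high (n : ℕ) [NeZero n] (κ lam : Fin d)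
    {s : Fin d → ℝ} (hs : ∀ ν, |s ν| ≤ Real.pi) {ρ : ℝ} (hρ : 0 < ρ) (hρ1 : ρ ≤ 1) {ν₀ : Fin d}
    (hν₀ : ρ ≤ |s ν₀|) (h4 : ∀ ν, |s ν| ≤ 4 * ρ) (α : List (Fin d)) (hm : 4 ≤ α.length) :
    ‖iterSliceDeriv (fun q => omegaC n κ q * tSubOne n lam q) α (ofRealVec s)‖ ≤
      Cwt d * ((α.length : ℝ) ^ α.length / rOf d ^ α.length) / ρ ^ (α.length - 4) := by
  have h := norm_iterSliceDeriv_omegaC_mul_tSubOne_le n κ lam hs hρ hρ1 hν₀ h4 α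
  have hr0 := rOf_pos d
  have hm' : 4 + (α.length - 4) = α.length := Nat.add_sub_of_le hm
  have key : Cwt d * ρ ^ 4 * ((α.length : ℝ) / (rOf d * ρ)) ^ α.length =
      Cwt d * ((α.length : ℝ) ^ α.length / rOf d ^ α.length) / ρ ^ (α.length - 4) := by
    rw [div_pow, mul_pow]
    have hρm : ρ ^ α.length = ρ ^ 4 * ρ ^ (α.length - 4) := by rw [← pow_add, hm']
    rw [hρm]
    field_simp
  rw [key] at h
  exact h

/-! ## Examples -/

/-- sanity (`d = 1`, the momentum `s = (1/2)`, scale `ρ = 1/2`): all hypotheses of §4 are met, so e.g. the second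
slice derivative of `ω₀` at `s` is bounded by `164·(2/(rOf 1 · ½))²`, for every `n ≥ 1`. -/
example (n : ℕ) (hn : 1 ≤ n) :
    ‖iterSliceDeriv (omegaC (d := 1) n 0) [0, 0] (ofRealVec fun _ => (1 / 2 : ℝ))‖ ≤
      164 * ((2 : ℝ) / (rOf 1 * (1 / 2))) ^ 2 := by
  have hπ := Real.pi_gt_three
  have h := norm_iterSliceDeriv_omegaC_le (d := 1) n hn 0 (s := fun _ => (1 / 2 : ℝ))
    (fun _ => by rw [abs_of_pos (by norm_num : (0:ℝ) < 1/2)]; linarith) (ρ := 1 / 2) (by norm_num) (by norm_num)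
    (ν₀ := 0) (by rw [abs_of_pos (by norm_num : (0:ℝ) < 1/2)])
    (fun _ => by rw [abs_of_pos (by norm_num : (0:ℝ) < 1/2)]; norm_num) [0, 0]
  simpa using h

end

end Literature.MathematicalPhysics.QuantumFieldTheory.Balaban1983to89.Beta.OmegaConormal
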